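import Summits.CriticalPhenomena.PercolationContinuityZ3.Theorems.PercNearOneGluingNoHeavyQuantCornerTheorem
import HarnessLib

/-!
# QUANT lane R8, T-DEC: the PREFIX PROPERTY of the corner run — the corner run at a lower layer `J′` is the corner run at the layer `J`
# restricted to the mids `≤ J′` (when the law has no low atom strictly between the layers); hence the leftovers of the window layers nest

builds on p205010 (kernel theorem, internal audit signed; external expert review pending)

Support file (`--supports stmt-CriticalPhenomena-4575`), QUANT lane seat prim-quant-census-2 (gen 57), rung R8 of
`run/shared/lean/prim/quant/LADDER.md`; memo `run/shared/lean/prim/quant/prim-quant-census-2-g57/WINDOW-ATOMS-G57.md` §2.2 / §4 (file H2).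
Theorems only, standard axioms, no sorries.  Continues the typer's corner run (`…QuantCornerRun`: `cornerFlow`, `cornerMidFlow`,
`cornerLeftover`, `CornerSucceeds`; `…QuantCornerSound`: `cornerFlow_inv`; `…QuantCornerTheorem`: `cornerPair_of_index`,
`decAtT_iff_cornerSucceeds`).

WHY.  In the proof of `LawDec.WindowExtremeSmall` (memo §2; Krein–Milman reduction `…QuantWindowAtomsExtreme`) the window layers
`J ∈ [j−w, j]` of ONE law are compared through ONE object: the corner run at the top layer.  At a lower layer `J′` the absorbers in
`(J′, J]` are giants instead of mids, the low atoms are the same (no low of the support lies in `(J′, J]`), and the corner run processes the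
same lows in the same order, offering each low the mids in increasing order — so what a low ships to the mids `≤ J′` does not depend on
the mids above `J′`.  This file proves exactly that, by a synchronised induction over the two runs' stages.

* `LawDec.usage_of_le_layers` — the usage rate of a mid `h ≤ J′ ≤ J` is the same at both layers.
* `LawDec.cornerFlow_row_eq_zero_of_gap` — in the run at layer `J`, the rows `J′ < l ≤ J` stay zero when those positions carry no low mass.
* **`LawDec.cornerMidFlow_prefix`** — `cornerMidFlow x T J′ M μ l h = cornerMidFlow x T J M μ l h` for every `l` and every `h ≤ J′`
  (`0 < x < 1`, `μ ≥ 0`, `J′ ≤ J`, no low mass in `(J′, J]`).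
* **`LawDec.cornerLeftover_prefix`** — `cornerLeftover x T J′ M μ l = cornerLeftover x T J M μ l + Σ_{J′ < h ≤ J} cornerMidFlow x T J M μ l h`:
  the leftover of a lower window layer is the top leftover plus what the top run ships to the columns that have become giants.

[this work]; corner rules / Monge arrays are classical (Hoffman 1963), nothing here is cited as a published result.  The gluing rows served
[cite: KozmaNitzan2024, Conjecture 3 (p. 15)]; product measure [cite: Grimmett1999, §1.3 p. 10].
-/

noncomputable section

namespace Summit.CriticalPhenomena.PercolationContinuityZ3.Theorems

namespace Quant

open Finset

namespace LawDec

/-! ### Layer-independence of the mid rates -/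

/-- **the usage rate of a mid does not depend on the layer**: for `h ≤ J′` and `h ≤ J` the gate is the minimal credit gate at both layers.
[this work] -/
theorem usage_of_le_layers (x T : ℝ) (J J' l h : ℕ) (hhJ : h ≤ J) (hhJ' : h ≤ J') :
    usage x T J l h = usage x T J' l h := by
  have h1 : ¬ (J + 1 ≤ h) := by omega
  have h2 : ¬ (J' + 1 ≤ h) := by omega
  simp only [usage, gateOf, if_neg h1, if_neg h2]

/-! ### Rows above the lower layer stay zero -/

/-- **in the corner run at layer `J`, a row `l` with `J′ < l ≤ J` carrying no low mass stays zero** at every stage (`μ ≥ 0`, `0 < x < 1`):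
an admissible stage on that row ships `min(0 − 0, residual/usage) = 0` since residuals are `≥ 0`. [this work] -/
theorem cornerFlow_row_eq_zero_of_gap (x T : ℝ) (J' J M : ℕ) (μ : ℕ → ℝ) (hx0 : 0 < x) (hx1 : x < 1) (hμ : ∀ k, 0 ≤ μ k)
    (hgap : ∀ l, J' < l → l ≤ J → 2 * (l : ℝ) < T → μ l = 0) :
    ∀ n, n ≤ (J + 1) * (J + 1) → ∀ a b, J' < a → cornerFlow x T J M μ n a b = 0 := by
  intro n
  induction n with
  | zero => intro _ a b _; rfl
  | succ n ih =>
    intro hn a b ha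
    have ihn := ih (by omega)
    obtain ⟨h0, hsup, hrow, hcol⟩ := cornerFlow_inv x T J M μ hx0 hx1 hμ n (by omega)
    rw [cornerFlow_succ]
    obtain ⟨l, h, hp⟩ : ∃ l h : ℕ, cornerPair J n = (l, h) := ⟨_, _, rfl⟩
    have hlJ : l ≤ J := by have := cornerPair_fst_le J n; rw [hp] at this; exact this
    rw [hp]
    by_cases hab : a = l ∧ b = h
    · obtain ⟨rfl, rfl⟩ := hab
      by_cases hadm : 2 * (a : ℝ) < T ∧ b ≤ M ∧ T < (a : ℝ) + b
      · obtain ⟨hlow, hbM, hcomp⟩ := hadm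
        rw [cornerUpdate_apply_self x T J M μ _ a b hlow hbM hcomp]
        have hrow0 : ∑ h' ∈ Finset.range (M + 1), cornerFlow x T J M μ n a h' = 0 :=
          Finset.sum_eq_zero fun h' _ => ihn a h' ha
        have hab' : a < b := by
          by_contra hge
          push Not at hge
          have : (b : ℝ) ≤ a := by exact_mod_cast hge
          linarith
        have hu : 0 < usage x T J a b := usage_pos_of_compat x T J a b hx0 hx1 hlow hab' (Or.inr hcomp)
        rw [hgap a ha hlJ hlow, hrow0, sub_zero]
        exact min_eq_left (div_nonneg (by linarith [hcol b]) hu.le)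
      · rw [cornerUpdate_of_not_admissible x T J M μ _ (a, b) hadm]
        exact ihn a b ha
    · rw [cornerUpdate_apply_of_ne x T J M μ _ (l, h) a b (by
        by_cases ha' : a = l
        · exact Or.inr (fun hb => hab ⟨ha', hb⟩)
        · exact Or.inl ha')]
      exact ihn a b ha

/-! ### The synchronised induction -/

section Prefix

variable (x T : ℝ) (J' J M : ℕ) (μ : ℕ → ℝ)

variable {x T J' J M μ}

/-- a stage of the `J`-run off the board (row `> J′` or column `> J′`) preserves agreement. -/
theorem cornerAgree_step_off (k' k : ℕ) (hA : (∀ i₀ j₀, i₀ ≤ J' → j₀ ≤ J' → cornerFlow x T J' M μ k' i₀ j₀ = cornerFlow x T J M μ k i₀ j₀))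
    (hoff : J' < (cornerPair J k).1 ∨ J' < (cornerPair J k).2) : (∀ i₀ j₀, i₀ ≤ J' → j₀ ≤ J' → cornerFlow x T J' M μ k' i₀ j₀ = cornerFlow x T J M μ (k + 1) i₀ j₀) := by
  intro a b ha hb
  rw [cornerFlow_succ, cornerUpdate_apply_of_ne x T J M μ _ (cornerPair J k) a b (by
    rcases hoff with h1 | h2
    · exact Or.inl (by omega)
    · exact Or.inr (by omega))]
  exact hA a b ha hb

/-- **the synchronised stage**: both runs treat the same pair `(l, h)` with `l, h ≤ J′` from agreeing states; they ship the same amount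
(`μ ≥ 0`, `0 < x < 1`, no low mass in `(J′, J]`). -/
theorem cornerAgree_step_sync (hx0 : 0 < x) (hx1 : x < 1) (hμ : ∀ k, 0 ≤ μ k) (hJ : J' ≤ J)
    (hgap : ∀ l, J' < l → l ≤ J → 2 * (l : ℝ) < T → μ l = 0)
    (k' k l h : ℕ) (hk' : k' < (J' + 1) * (J' + 1)) (hk : k < (J + 1) * (J + 1)) (hl : l ≤ J') (hh : h ≤ J')
    (hp' : cornerPair J' k' = (l, h)) (hp : cornerPair J k = (l, h)) (hA : (∀ i₀ j₀, i₀ ≤ J' → j₀ ≤ J' → cornerFlow x T J' M μ k' i₀ j₀ = cornerFlow x T J M μ k i₀ j₀)) :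
    (∀ i₀ j₀, i₀ ≤ J' → j₀ ≤ J' → cornerFlow x T J' M μ (k' + 1) i₀ j₀ = cornerFlow x T J M μ (k + 1) i₀ j₀) := by
  intro a b ha hb
  rw [cornerFlow_succ, cornerFlow_succ, hp', hp]
  by_cases hadm : 2 * (l : ℝ) < T ∧ h ≤ M ∧ T < (l : ℝ) + h
  · obtain ⟨hlow, hhM, hcomp⟩ := hadm
    by_cases hab : a = l ∧ b = h
    · obtain ⟨rfl, rfl⟩ := hab
      rw [cornerUpdate_apply_self x T J' M μ _ a b hlow hhM hcomp, cornerUpdate_apply_self x T J M μ _ a b hlow hhM hcomp]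
      -- stage indices
      have hidx' : (J' - a) * (J' + 1) + b = k' := by
        have := cornerPair_index J' k' hk'; rw [hp'] at this; exact this
      have hidx : (J - a) * (J + 1) + b = k := by
        have := cornerPair_index J k hk; rw [hp] at this; exact this
      obtain ⟨-, hsup', -, -⟩ := cornerFlow_inv x T J' M μ hx0 hx1 hμ k' hk'.le
      obtain ⟨-, hsup, -, -⟩ := cornerFlow_inv x T J M μ hx0 hx1 hμ k hk.le
      -- the row sums agree: columns `> b` of row `a` are still empty in both runs
      have hrow : ∑ h' ∈ Finset.range (M + 1), cornerFlow x T J' M μ k' a h'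
          = ∑ h' ∈ Finset.range (M + 1), cornerFlow x T J M μ k a h' := by
        refine Finset.sum_congr rfl fun h' _ => ?_
        by_cases hh' : h' ≤ J'
        · exact hA a h' ha hh'
        · have e1 : cornerFlow x T J' M μ k' a h' = 0 := by
            by_contra hne
            have := (hsup' a h' hne).2.1
            omega
          have e2 : cornerFlow x T J M μ k a h' = 0 := by
            by_contra hne
            obtain ⟨-, -, -, -, -, h6⟩ := hsup a h' hne
            rw [← hidx] at h6
            have : b < h' := by omega
            have : h' < b := by
              by_contra hge
              push Not at hge
              have := Nat.add_le_add_left hge ((J - a) * (J + 1))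
              omega
            omega
          rw [e1, e2]
      -- the column loads agree: rows `> J′` of the `J`-run are empty, the rates of the mid `b` coincide
      have hcolsum : ∑ l' ∈ Finset.range (J' + 1), usage x T J' l' b * cornerFlow x T J' M μ k' l' b
          = ∑ l' ∈ Finset.range (J + 1), usage x T J l' b * cornerFlow x T J M μ k l' b := by
        have hsub : Finset.range (J' + 1) ⊆ Finset.range (J + 1) := fun l' hl' =>
          Finset.mem_range.2 (by have := Finset.mem_range.1 hl'; omega)
        have hzero : ∀ l' ∈ Finset.range (J + 1), l' ∉ Finset.range (J' + 1) →
            usage x T J l' b * cornerFlow x T J M μ k l' b = 0 := by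
          intro l' hl' hnot
          have hl'J' : J' < l' := by
            by_contra hle; push Not at hle
            exact hnot (Finset.mem_range.2 (Nat.lt_succ_of_le hle))
          rw [cornerFlow_row_eq_zero_of_gap x T J' J M μ hx0 hx1 hμ hgap k hk.le l' b hl'J', mul_zero]
        rw [← Finset.sum_subset hsub hzero]
        refine Finset.sum_congr rfl fun l' hl' => ?_
        have hl'J' : l' ≤ J' := Nat.lt_succ_iff.1 (Finset.mem_range.1 hl')
        rw [usage_of_le_layers x T J' J l' b hb (hb.trans hJ), hA l' b hl'J' hb]
      rw [hrow, hcolsum, usage_of_le_layers x T J' J a b hb (hb.trans hJ)]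
    · rw [cornerUpdate_apply_of_ne x T J' M μ _ (l, h) a b (by
        by_cases ha' : a = l
        · exact Or.inr (fun hb' => hab ⟨ha', hb'⟩)
        · exact Or.inl ha'),
        cornerUpdate_apply_of_ne x T J M μ _ (l, h) a b (by
        by_cases ha' : a = l
        · exact Or.inr (fun hb' => hab ⟨ha', hb'⟩)
        · exact Or.inl ha')]
      exact hA a b ha hb
  · rw [cornerUpdate_of_not_admissible x T J' M μ _ (l, h) hadm, cornerUpdate_of_not_admissible x T J M μ _ (l, h) hadm]
    exact hA a b ha hb

/-- **agreement before each low**: for `a ≤ J′+1`, the `J′`-run before its stage `a(J′+1)` (about to treat the low `J′ − a`) agrees with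
the `J`-run before its stage `(a + (J − J′))(J+1)` (about to treat the same low). -/
theorem cornerAgree_lows (hx0 : 0 < x) (hx1 : x < 1) (hμ : ∀ k, 0 ≤ μ k) (hJ : J' ≤ J)
    (hgap : ∀ l, J' < l → l ≤ J → 2 * (l : ℝ) < T → μ l = 0) :
    ∀ a, a ≤ J' + 1 → (∀ i₀ j₀, i₀ ≤ J' → j₀ ≤ J' → cornerFlow x T J' M μ (a * (J' + 1)) i₀ j₀ = cornerFlow x T J M μ ((a + (J - J')) * (J + 1)) i₀ j₀) := by
  intro a
  induction a with
  | zero =>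
    intro _ c b hc hb
    rw [zero_mul, cornerFlow_zero, zero_add]
    -- before the low `J′` the `J`-run has not touched the rows `≤ J′`
    obtain ⟨-, hsup, -, -⟩ := cornerFlow_inv x T J M μ hx0 hx1 hμ ((J - J') * (J + 1))
      (Nat.mul_le_mul_right _ (by omega))
    symm
    by_contra hne
    obtain ⟨-, -, -, -, -, h6⟩ := hsup c b hne
    have : (J - J') * (J + 1) ≤ (J - c) * (J + 1) := Nat.mul_le_mul_right _ (by omega)
    omega
  | succ a ih =>
    intro ha
    have hA0 := ih (by omega)
    have haJ' : a ≤ J' := by omega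
    -- the mids `b ≤ J′` of the low `J′ − a`, synchronised
    have hB : ∀ b, b ≤ J' + 1 → (∀ i₀ j₀, i₀ ≤ J' → j₀ ≤ J' → cornerFlow x T J' M μ (a * (J' + 1) + b) i₀ j₀ = cornerFlow x T J M μ ((a + (J - J')) * (J + 1) + b) i₀ j₀) := by
      intro b
      induction b with
      | zero => intro _; simpa using hA0
      | succ b ihb =>
        intro hb
        have hbJ' : b ≤ J' := by omega
        have hk' : a * (J' + 1) + b < (J' + 1) * (J' + 1) := by nlinarith
        have hk : (a + (J - J')) * (J + 1) + b < (J + 1) * (J + 1) := by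
          have : a + (J - J') ≤ J := by omega
          nlinarith
        have hp' : cornerPair J' (a * (J' + 1) + b) = (J' - a, b) :=
          cornerPair_of_index J' (J' - a) b _ (Nat.sub_le _ _) hbJ' (by rw [Nat.sub_sub_self haJ'])
        have hp : cornerPair J ((a + (J - J')) * (J + 1) + b) = (J' - a, b) :=
          cornerPair_of_index J (J' - a) b _ (by omega) (by omega) (by
            have : J - (J' - a) = a + (J - J') := by omega
            rw [this])
        exact cornerAgree_step_sync hx0 hx1 hμ hJ hgap _ _ (J' - a) b hk' hk (Nat.sub_le _ _) hbJ' hp' hp (ihb (by omega))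
    -- the mids `J′ < c ≤ J` of that low in the `J`-run are off the board
    have hC : ∀ c, J' + 1 ≤ c → c ≤ J + 1 →
        (∀ i₀ j₀, i₀ ≤ J' → j₀ ≤ J' → cornerFlow x T J' M μ ((a + 1) * (J' + 1)) i₀ j₀ = cornerFlow x T J M μ ((a + (J - J')) * (J + 1) + c) i₀ j₀) := by
      intro c
      induction c with
      | zero => intro h _; omega
      | succ c ihc =>
        intro hc1 hc2
        rcases Nat.eq_or_lt_of_le hc1 with heq | hlt
        · rw [← heq, show (a + 1) * (J' + 1) = a * (J' + 1) + (J' + 1) by ring]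
          exact hB (J' + 1) le_rfl
        · have hA1 := ihc (by omega) (by omega)
          have hp : cornerPair J ((a + (J - J')) * (J + 1) + c) = (J' - a, c) :=
            cornerPair_of_index J (J' - a) c _ (by omega) (by omega) (by
              have : J - (J' - a) = a + (J - J') := by omega
              rw [this])
          have hstep := cornerAgree_step_off ((a + 1) * (J' + 1)) ((a + (J - J')) * (J + 1) + c) hA1
            (Or.inr (by rw [hp]; show J' < c; omega))
          rw [show (a + (J - J')) * (J + 1) + (c + 1) = (a + (J - J')) * (J + 1) + c + 1 by ring]
          exact hstep
    have := hC (J + 1) (by omega) le_rfl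
    rw [show (a + (J - J')) * (J + 1) + (J + 1) = (a + 1 + (J - J')) * (J + 1) by ring] at this
    exact this

end Prefix

/-! ### The prefix property and the nesting of leftovers -/

/-- **THE PREFIX PROPERTY OF THE CORNER RUN** (`0 < x < 1`, `μ ≥ 0`, `J′ ≤ J`, no low mass strictly between the layers): on the mids
`h ≤ J′` the corner run at layer `J′` IS the corner run at layer `J`. [this work] -/
theorem cornerMidFlow_prefix (x T : ℝ) (J' J M : ℕ) (μ : ℕ → ℝ) (hx0 : 0 < x) (hx1 : x < 1) (hμ : ∀ k, 0 ≤ μ k) (hJ : J' ≤ J)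
    (hgap : ∀ l, J' < l → l ≤ J → 2 * (l : ℝ) < T → μ l = 0) (l h : ℕ) (hh : h ≤ J') :
    cornerMidFlow x T J' M μ l h = cornerMidFlow x T J M μ l h := by
  by_cases hl : l ≤ J'
  · have hA := cornerAgree_lows (x := x) (T := T) (J' := J') (J := J) (M := M) (μ := μ) hx0 hx1 hμ hJ hgap (J' + 1) le_rfl
    rw [show (J' + 1 + (J - J')) * (J + 1) = (J + 1) * (J + 1) by
      rw [show J' + 1 + (J - J') = J + 1 by omega]] at hA
    exact hA l h hl hh
  · -- a row above `J′`: empty in both runs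
    push Not at hl
    obtain ⟨-, hsup', -, -⟩ := cornerFlow_inv x T J' M μ hx0 hx1 hμ ((J' + 1) * (J' + 1)) le_rfl
    have e1 : cornerMidFlow x T J' M μ l h = 0 := by
      by_contra hne
      have := (hsup' l h hne).1
      omega
    by_cases hlJ : l ≤ J
    · rw [e1, cornerMidFlow, cornerFlow_row_eq_zero_of_gap x T J' J M μ hx0 hx1 hμ hgap _ le_rfl l h hl]
    · push Not at hlJ
      obtain ⟨-, hsup, -, -⟩ := cornerFlow_inv x T J M μ hx0 hx1 hμ ((J + 1) * (J + 1)) le_rfl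
      have e2 : cornerMidFlow x T J M μ l h = 0 := by
        by_contra hne
        have := (hsup l h hne).1
        omega
      rw [e1, e2]

/-- **NESTING OF THE LEFTOVERS** (same hypotheses): the leftover of the low `l` at the lower layer `J′` equals its leftover at the layer `J`
plus what the layer-`J` run ships from `l` to the mids `J′ < h ≤ J` (which are giants at layer `J′`). [this work] -/
theorem cornerLeftover_prefix (x T : ℝ) (J' J M : ℕ) (μ : ℕ → ℝ) (hx0 : 0 < x) (hx1 : x < 1) (hμ : ∀ k, 0 ≤ μ k) (hJ : J' ≤ J)
    (hgap : ∀ l, J' < l → l ≤ J → 2 * (l : ℝ) < T → μ l = 0) (l : ℕ) :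
    cornerLeftover x T J' M μ l = cornerLeftover x T J M μ l
      + ∑ h ∈ Finset.range (M + 1), (if J' < h ∧ h ≤ J then cornerMidFlow x T J M μ l h else 0) := by
  unfold cornerLeftover
  obtain ⟨-, hsup', -, -⟩ := cornerFlow_inv x T J' M μ hx0 hx1 hμ ((J' + 1) * (J' + 1)) le_rfl
  obtain ⟨-, hsup, -, -⟩ := cornerFlow_inv x T J M μ hx0 hx1 hμ ((J + 1) * (J + 1)) le_rfl
  have e : ∀ h, cornerMidFlow x T J' M μ l h
      = cornerMidFlow x T J M μ l h - (if J' < h ∧ h ≤ J then cornerMidFlow x T J M μ l h else 0) := by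
    intro h
    by_cases hh : h ≤ J'
    · rw [if_neg (fun hc => by omega), sub_zero]
      exact cornerMidFlow_prefix x T J' J M μ hx0 hx1 hμ hJ hgap l h hh
    · push Not at hh
      have e1 : cornerMidFlow x T J' M μ l h = 0 := by
        by_contra hne
        have := (hsup' l h hne).2.1
        omega
      by_cases hhJ : h ≤ J
      · rw [if_pos ⟨hh, hhJ⟩, sub_self]; exact e1
      · push Not at hhJ
        have e2 : cornerMidFlow x T J M μ l h = 0 := by
          by_contra hne
          have := (hsup l h hne).2.1
          omega
        rw [if_neg (fun hc => by omega), e1, e2, sub_zero]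
  simp only [e, Finset.sum_sub_distrib]
  ring

end LawDec

end Quant

end Summit.CriticalPhenomena.PercolationContinuityZ3.Theorems
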